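import Literature.Analysis.FluidPDE.Tao2016AveragedNS.DelayCircuitHolds
import Literature.Analysis.ODE.OneSidedComparison
import HarnessLib

/-!
# Tao 2016, §5.5 — shadowing: the delay circuit fires along every pseudo-orbit (robust Theorem 5.3)

T. Tao, *Finite time blowup for an averaged three-dimensional Navier–Stokes equation*, J. Amer.
Math. Soc. **29** (2016) 601–674 = arXiv:1402.0290, §5.5 (the five-mode delay circuit (5.5)/(5.6)
and Theorem 5.3) and Remark 6.1 / §6.4 (the cascade is an infinite family of rescaled copies of that
circuit, each driven by the others and by the dissipation through error terms). [`Tao2016AveragedNS`]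
E. Hairer, S. P. Nørsett, G. Wanner, *Solving Ordinary Differential Equations I*, 2nd ed. (Springer
1993), §I.10, Theorem 10.2 "the fundamental lemma" (p. 58): an approximate solution with defect
`≤ ε` of an `L`-Lipschitz ODE stays within `ϱe^{L(x-x₀)} + (ε/L)(e^{L(x-x₀)} - 1)` of the solution.
[`HairerNorsettWanner1993`]

HONEST FRAMING (cell pub-fluidc, verbatim): *low prior, high value-of-information experiment on
Tao's machine paradigm; NOT a claim that NS blows up.* Everything in this file is finite-dimensional
ODE theory about Tao's TOY circuit; nothing is asserted about the Navier–Stokes equations.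

## Why this file exists (cell pub-fluidc, ASSEMBLY.md §2f item 5 = recommendation R2)

The cell's gadget interfaces (`FluidComputer.PumpGadget.fires`, `GadgetLibrary.step`) type the
OUTPUT of one generation of Tao's machine — "every input state is carried into the output class
within the tick" — as a hypothesis about true Navier–Stokes. R2 asks for the ARCHITECTURE layer in
which `fires` becomes a theorem from two separately refutable hypotheses: SHADOWING (the amplitudes
of the designed modes along the true trajectory follow the reference circuit (5.5) up to a small
defect, in the generation's rescaled units) and LEAKAGE. This file supplies the ODE half of that
layer, kernel-checked, with explicit constants:

* `IsPseudoOrbit F δ R T Y` — a `δ`-pseudo-orbit (defect `‖∂ₜ⁺Y - F(Y)‖ ≤ δ`) of an autonomous field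
  `F` on `ℝ^m` over `[0,T]`, confined to the sup-ball of radius `R`; exact trajectories are
  `0`-pseudo-orbits (`IsPseudoOrbit.of_hasDerivAt`).
* `IsPseudoOrbit.norm_sub_le` — the FUNDAMENTAL LEMMA (HNW Thm I.10.2; Mathlib's
  `dist_le_of_approx_trajectories_ODE_of_mem`): two pseudo-orbits with defects `δ₁, δ₂` of a field
  that is `L`-Lipschitz on the ball stay within `gronwallBound δ₀ L (δ₁+δ₂) t` of each other.
* EXPLICIT LIPSCHITZ CONSTANTS on sup-balls for the wired gates of §5 (`lipschitzOnWith_pumpOn`,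
  `lipschitzOnWith_amplifierOn`, `lipschitzOnWith_rotorOn`: a gate of coupling `κ` is
  `4|κ|R`-Lipschitz on the ball of radius `R`) and, by the gate decomposition
  `delayCircuit_eq_gates`, for (5.5): `delayLipschitz K ε R = 4R(ε + ε²e^{-K¹⁰} + ε⁻¹K¹⁰ + ε⁻² + K)`
  (`lipschitzOnWith_delayCircuit`, `coe_delayLipschitz`), `≤ 20 R K¹⁰ ε⁻²` for `0 < ε ≤ 1 ≤ K`
  (`delayLipschitz_le`).
* SHADOWING OF THE GATE (`IsPseudoOrbit.norm_sub_delaySolution_le`): a `δ`-pseudo-orbit of (5.5)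
  issued `δ₀`-close to (5.6) stays within `gronwallBound δ₀ (delayLipschitz K ε R) δ t` of THE
  trajectory `delaySolution K ε` (`GlobalWellposedness.lean`) on `[0,T]`.
* ROBUST THEOREM 5.3 (`IsPseudoOrbit.abruptTransition_shadow`, unconditional form
  `pseudoOrbit_delayedAbruptTransition` via the tree's proof `DelayedAbruptTransition_holds` of
  Theorem 5.3): every such pseudo-orbit exhibits the delayed abrupt energy transition of Theorem 5.3
  with the tolerance `C K⁻¹⁰` replaced by `C K⁻¹⁰ + (shadowing error)`, on the window `[0,T]`.
* THE NUMBER (`IsPseudoOrbit.fires_of_budget`, `shadowRadius`,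
  `fires_of_le_shadowRadius`, `shadowRadius_le`): the forcing budget
  `δ₀ + δ·T ≤ shadowRadius K ε R T θ := θ·exp(-delayLipschitz K ε R · T)` guarantees that the
  pseudo-orbit's output mode reaches `≥ 1 - C K⁻¹⁰ - θ` from `t_c + K^{-1/2}` on (and the other
  printed conclusions up to `θ`); and `shadowRadius ≤ θ·exp(-4RT/ε²)` — EXPONENTIALLY SMALL in the
  rotor speed `ε⁻²` (indeed in `ε⁻¹K¹⁰`, the amplifier gain).

## What this says for the dictionary (DICTIONARY.md §8) — and what it does NOT say

* SUFFICIENT, not necessary. Grönwall shadowing is the worst case over all forcings of sup-size `δ`;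
  it ignores that the rotor is an isometry and that the pumps are monotone. Whether the gate
  tolerates larger GENERIC defects is not decided here (nor in print). What print certifies for a
  STRUCTURED class (dissipation-type, energy-non-injecting envelope forcing of the whole cascade) is
  `Stability.lean` (layer B/C: tolerance `C₁(1+ε₀)^{-n₀/2}` in rescaled units, Thm 6.2 as typed).
* Consistency with the source: Tao never needs more. In the proof of Prop. 6.5 the rescaled level
  equations (6.45)–(6.48) carry cross-level/dissipative errors of relative size `(1+ε₀)^{-n₀/2}`
  (times bounded factors), and `n₀` is chosen LAST in the hierarchy `1 ≪ 1/ε₀ ≪ K ≪ 1/ε ≪ n₀`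
  (§6.1), so the available smallness beats any `exp(-O_{K,ε}(1))` requirement such as
  `shadowRadius`. For TRUE Navier–Stokes the defect of a candidate gadget relative to its designed
  circuit (pressure, undesigned triads) does not shrink with the generation — this is gap F2/F3 of
  DIVERGENCE.md, now with a kernel-checked yardstick: generic defects must be below `shadowRadius`
  (astronomically small), or a structured shadowing theory of the gate must be supplied.
* Level `n` (Remark 6.1): the generation-`n` copy is `∂ₜY = Λₙ • delayCircuit K ε Y` with amplitude
  `eₙ` (`hasDerivAt_delayCircuit_rescale`, `DelayCircuit.lean`); in the rescaled variables
  `s = Λₙeₙt`, `Ỹ = eₙ⁻¹Y` an absolute defect `δ_abs` becomes `δ_abs/(Λₙeₙ²)`, so the admissible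
  forcing RELATIVE TO THE GENERATION'S NATURAL RATE `Λₙeₙ²` is the generation-independent number
  `shadowRadius` — the "uniform spec over all scales" the gadget library asks for
  (`IsPseudoOrbit.rescale`: a `δ`-pseudo-orbit of the level-`n` copy is, after rescaling, a
  `δ/(Λₙeₙ²)`-pseudo-orbit of the unit circuit).

## Design choices
* Sup norm on `Fin m → ℝ` throughout (as in the sibling files); balls are `Metric.closedBall 0 R`
  with `R : ℝ≥0`, Lipschitz constants are `ℝ≥0` (Mathlib's `LipschitzOnWith`), the shadowing error
  is Mathlib's `gronwallBound δ₀ L δ t = δ₀e^{Lt} + (δ/L)(e^{Lt} - 1)`.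
* Pseudo-orbits carry right derivatives within `Ici t` on `[0,T)` and continuity on `[0,T]` — exactly
  the hypotheses of Mathlib's fundamental lemma — so that projections of PDE trajectories with
  one-sided time derivatives qualify.
* No named facts, no new axioms; three definitions (`IsPseudoOrbit`, `delayLipschitz`,
  `shadowRadius`). Constants are explicit and unoptimised.

## References
* T. Tao, JAMS 29 (2016) 601–674, arXiv:1402.0290: §5.5 (5.5)/(5.6), Theorem 5.3; Remark 6.1;
  §6.1 (hierarchy of parameters); §6.4 (6.45)–(6.48). [`Tao2016AveragedNS`]
* E. Hairer, S. P. Nørsett, G. Wanner, Solving ODE I (1993), Thm I.10.2 p. 58. [`HairerNorsettWanner1993`]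
-/

noncomputable section

open Set Metric
open scoped NNReal

namespace Literature.Analysis.FluidPDE.Tao2016AveragedNS

variable {m : ℕ}

/-! ## Pseudo-orbits and the fundamental lemma -/

/-- A **`δ`-pseudo-orbit** of the autonomous vector field `F` on `ℝ^m` over the window `[0,T]`,
confined to the closed sup-ball of radius `R`: `Y` is continuous on `[0,T]`, has at every
`t ∈ [0,T)` a right derivative `V` with defect `‖V - F(Y t)‖ ≤ δ`, and `‖Y t‖ ≤ R` on `[0,T)`
("approximate solution", HNW §I.10). [cite: HairerNorsettWanner1993, Thm I.10.2] -/
structure IsPseudoOrbit (F : (Fin m → ℝ) → (Fin m → ℝ)) (δ : ℝ) (R : ℝ≥0) (T : ℝ)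
    (Y : ℝ → Fin m → ℝ) : Prop where
  /-- continuity on the closed window -/
  continuousOn : ContinuousOn Y (Icc 0 T)
  /-- right-differentiable with defect at most `δ` on `[0,T)` -/
  defect : ∀ t ∈ Ico 0 T, ∃ V : Fin m → ℝ, HasDerivWithinAt Y V (Ici t) t ∧ ‖V - F (Y t)‖ ≤ δ
  /-- confined to the sup-ball of radius `R` on `[0,T)` -/
  norm_le : ∀ t ∈ Ico 0 T, ‖Y t‖ ≤ (R : ℝ)

/-- An exact global trajectory confined to the ball is a `0`-pseudo-orbit. [folklore] -/
theorem IsPseudoOrbit.of_hasDerivAt {F : (Fin m → ℝ) → (Fin m → ℝ)} {R : ℝ≥0} {T : ℝ}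
    {X : ℝ → Fin m → ℝ} (hX : ∀ t, HasDerivAt X (F (X t)) t)
    (hR : ∀ t ∈ Ico 0 T, ‖X t‖ ≤ (R : ℝ)) : IsPseudoOrbit F 0 R T X where
  continuousOn := fun t _ => (hX t).continuousAt.continuousWithinAt
  defect := fun t _ => ⟨F (X t), (hX t).hasDerivWithinAt, by simp⟩
  norm_le := hR

/-- Pseudo-orbits are monotone in the defect, the radius and (anti-)monotone in the window. [folklore] -/
theorem IsPseudoOrbit.mono {F : (Fin m → ℝ) → (Fin m → ℝ)} {δ δ' : ℝ} {R R' : ℝ≥0} {T T' : ℝ}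
    {Y : ℝ → Fin m → ℝ} (h : IsPseudoOrbit F δ R T Y) (hδ : δ ≤ δ') (hR : R ≤ R') (hT : T' ≤ T) :
    IsPseudoOrbit F δ' R' T' Y where
  continuousOn := h.continuousOn.mono (Icc_subset_Icc_right hT)
  defect := fun t ht => by
    obtain ⟨V, hV, hVδ⟩ := h.defect t ⟨ht.1, ht.2.trans_le hT⟩
    exact ⟨V, hV, hVδ.trans hδ⟩
  norm_le := fun t ht => (h.norm_le t ⟨ht.1, ht.2.trans_le hT⟩).trans (NNReal.coe_le_coe.2 hR)

/-- **The fundamental lemma (shadowing).** Two pseudo-orbits of the same field `F`, with defects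
`δ₁`, `δ₂`, confined to a sup-ball on which `F` is `L`-Lipschitz, and `δ₀`-close at time `0`,
stay within `gronwallBound δ₀ L (δ₁ + δ₂) t = δ₀e^{Lt} + ((δ₁+δ₂)/L)(e^{Lt} - 1)` of each other on
`[0,T]` (HNW (10.14); Mathlib `dist_le_of_approx_trajectories_ODE_of_mem`).
[cite: HairerNorsettWanner1993, Thm I.10.2] -/
theorem IsPseudoOrbit.norm_sub_le {F : (Fin m → ℝ) → (Fin m → ℝ)} {L R : ℝ≥0} {T δ₁ δ₂ δ₀ : ℝ}
    (hF : LipschitzOnWith L F (closedBall (0 : Fin m → ℝ) R)) {X Y : ℝ → Fin m → ℝ}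
    (hX : IsPseudoOrbit F δ₁ R T X) (hY : IsPseudoOrbit F δ₂ R T Y) (h0 : ‖X 0 - Y 0‖ ≤ δ₀)
    {t : ℝ} (ht : t ∈ Icc 0 T) : ‖X t - Y t‖ ≤ gronwallBound δ₀ L (δ₁ + δ₂) t := by
  choose! VX hVX hVXδ using hX.defect
  choose! VY hVY hVYδ using hY.defect
  have h := dist_le_of_approx_trajectories_ODE_of_mem (v := fun _ => F)
    (s := fun _ => closedBall (0 : Fin m → ℝ) R) (K := L) (f := X) (g := Y) (f' := VX) (g' := VY)
    (a := 0) (b := T) (εf := δ₁) (εg := δ₂) (δ := δ₀) (fun _ _ => hF) hX.continuousOn hVX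
    (fun t ht => by rw [dist_eq_norm]; exact hVXδ t ht)
    (fun t ht => mem_closedBall_zero_iff.2 (hX.norm_le t ht)) hY.continuousOn hVY
    (fun t ht => by rw [dist_eq_norm]; exact hVYδ t ht)
    (fun t ht => mem_closedBall_zero_iff.2 (hY.norm_le t ht)) (by rw [dist_eq_norm]; exact h0) t ht
  rwa [dist_eq_norm, sub_zero] at h

/-! ## Explicit Lipschitz constants of the gates of §5 on sup-balls -/

/-- A coordinate is bounded by the sup norm bound. [folklore] -/
theorem abs_apply_le_of_norm_le {X : Fin m → ℝ} {R : ℝ} (h : ‖X‖ ≤ R) (i : Fin m) : |X i| ≤ R :=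
  le_trans (by rw [← Real.norm_eq_abs]; exact norm_le_pi_norm X i) h

/-- Quadratic monomials are `2R`-Lipschitz on the sup-ball of radius `R`:
`|XᵢXⱼ - YᵢYⱼ| ≤ 2R‖X - Y‖`. [folklore] -/
theorem abs_mul_sub_mul_le {X Y : Fin m → ℝ} {R : ℝ} (hX : ‖X‖ ≤ R) (hY : ‖Y‖ ≤ R)
    (i j : Fin m) : |X i * X j - Y i * Y j| ≤ 2 * R * ‖X - Y‖ := by
  have hi : |X i - Y i| ≤ ‖X - Y‖ := by
    rw [← Real.norm_eq_abs]; exact norm_le_pi_norm (X - Y) i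
  have hj : |X j - Y j| ≤ ‖X - Y‖ := by
    rw [← Real.norm_eq_abs]; exact norm_le_pi_norm (X - Y) j
  have hXj := abs_apply_le_of_norm_le hX j
  have hYi := abs_apply_le_of_norm_le hY i
  have hR : 0 ≤ R := (norm_nonneg _).trans hX
  calc |X i * X j - Y i * Y j| = |(X i - Y i) * X j + Y i * (X j - Y j)| := by congr 1; ring
    _ ≤ |(X i - Y i) * X j| + |Y i * (X j - Y j)| := abs_add_le _ _
    _ = |X i - Y i| * |X j| + |Y i| * |X j - Y j| := by rw [abs_mul, abs_mul]
    _ ≤ ‖X - Y‖ * R + R * ‖X - Y‖ :=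
        add_le_add (mul_le_mul hi hXj (abs_nonneg _) (norm_nonneg _))
          (mul_le_mul hYi hj (abs_nonneg _) hR)
    _ = 2 * R * ‖X - Y‖ := by ring

/-- Norm of a two-spike vector built from two quadratic-monomial differences. [folklore] -/
theorem norm_single_add_single_le {i j : Fin m} {κ a b R d : ℝ} (ha : |a| ≤ 2 * R * d)
    (hb : |b| ≤ 2 * R * d) :
    ‖(Pi.single i (-(κ * a)) + Pi.single j (κ * b) : Fin m → ℝ)‖ ≤ 4 * |κ| * R * d := by
  have h1 : ‖(Pi.single i (-(κ * a)) : Fin m → ℝ)‖ ≤ |κ| * (2 * R * d) := by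
    rw [Pi.norm_single, Real.norm_eq_abs, abs_neg, abs_mul]; gcongr
  have h2 : ‖(Pi.single j (κ * b) : Fin m → ℝ)‖ ≤ |κ| * (2 * R * d) := by
    rw [Pi.norm_single, Real.norm_eq_abs, abs_mul]; gcongr
  calc _ ≤ |κ| * (2 * R * d) + |κ| * (2 * R * d) := norm_add_le_of_le h1 h2
    _ = 4 * |κ| * R * d := by ring

/-- A wired **pump** of coupling `κ` is `4|κ|R`-Lipschitz on the sup-ball of radius `R`.
[cite: Tao2016AveragedNS, §5.1 (pump)] -/
theorem lipschitzOnWith_pumpOn (κ : ℝ) (i j : Fin m) (R : ℝ≥0) :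
    LipschitzOnWith (4 * ‖κ‖₊ * R) (pumpOn κ i j) (closedBall (0 : Fin m → ℝ) R) := by
  refine LipschitzOnWith.of_dist_le_mul fun X hX Y hY => ?_
  rw [mem_closedBall_zero_iff] at hX hY
  have hsub : pumpOn κ i j X - pumpOn κ i j Y =
      Pi.single i (-(κ * (X i * X j - Y i * Y j))) + Pi.single j (κ * (X i * X i - Y i * Y i)) := by
    ext l
    simp only [pumpOn, Pi.sub_apply, Pi.add_apply, Pi.single_apply]
    split_ifs <;> ring
  rw [dist_eq_norm, dist_eq_norm, hsub]
  refine (norm_single_add_single_le (abs_mul_sub_mul_le hX hY i j)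
    (abs_mul_sub_mul_le hX hY i i)).trans_eq ?_
  simp only [NNReal.coe_mul, NNReal.coe_ofNat, coe_nnnorm, Real.norm_eq_abs]

/-- A wired **amplifier** of coupling `κ` is `4|κ|R`-Lipschitz on the sup-ball of radius `R`.
[cite: Tao2016AveragedNS, §5.3 (amp)] -/
theorem lipschitzOnWith_amplifierOn (κ : ℝ) (i j : Fin m) (R : ℝ≥0) :
    LipschitzOnWith (4 * ‖κ‖₊ * R) (amplifierOn κ i j) (closedBall (0 : Fin m → ℝ) R) := by
  refine LipschitzOnWith.of_dist_le_mul fun X hX Y hY => ?_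
  rw [mem_closedBall_zero_iff] at hX hY
  have hsub : amplifierOn κ i j X - amplifierOn κ i j Y =
      Pi.single i (-(κ * (X j * X j - Y j * Y j))) + Pi.single j (κ * (X i * X j - Y i * Y j)) := by
    ext l
    simp only [amplifierOn, Pi.sub_apply, Pi.add_apply, Pi.single_apply]
    split_ifs <;> ring
  rw [dist_eq_norm, dist_eq_norm, hsub]
  refine (norm_single_add_single_le (abs_mul_sub_mul_le hX hY j j)
    (abs_mul_sub_mul_le hX hY i j)).trans_eq ?_
  simp only [NNReal.coe_mul, NNReal.coe_ofNat, coe_nnnorm, Real.norm_eq_abs]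

/-- A wired **rotor** of coupling `κ` is `4|κ|R`-Lipschitz on the sup-ball of radius `R`.
[cite: Tao2016AveragedNS, §5.4 (rotor-def)] -/
theorem lipschitzOnWith_rotorOn (κ : ℝ) (i j k : Fin m) (R : ℝ≥0) :
    LipschitzOnWith (4 * ‖κ‖₊ * R) (rotorOn κ i j k) (closedBall (0 : Fin m → ℝ) R) := by
  refine LipschitzOnWith.of_dist_le_mul fun X hX Y hY => ?_
  rw [mem_closedBall_zero_iff] at hX hY
  have hsub : rotorOn κ i j k X - rotorOn κ i j k Y =
      Pi.single i (-(κ * (X j * X k - Y j * Y k))) + Pi.single j (κ * (X i * X k - Y i * Y k)) := by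
    ext l
    simp only [rotorOn, Pi.sub_apply, Pi.add_apply, Pi.single_apply]
    split_ifs <;> ring
  rw [dist_eq_norm, dist_eq_norm, hsub]
  refine (norm_single_add_single_le (abs_mul_sub_mul_le hX hY j k)
    (abs_mul_sub_mul_le hX hY i k)).trans_eq ?_
  simp only [NNReal.coe_mul, NNReal.coe_ofNat, coe_nnnorm, Real.norm_eq_abs]

/-! ## The delay circuit (5.5): explicit Lipschitz constant and shadowing -/

/-- **Explicit Lipschitz constant of (5.5)** on the sup-ball of radius `R`: the sum of the five gate
constants `4|κ|R` over the couplings `ε`, `ε²e^{-K¹⁰}`, `ε⁻¹K¹⁰`, `ε⁻²`, `K` of p. 28.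
[cite: Tao2016AveragedNS, §5.5 (5.5)] -/
def delayLipschitz (K ε : ℝ) (R : ℝ≥0) : ℝ≥0 :=
  4 * ‖ε‖₊ * R + 4 * ‖ε ^ 2 * Real.exp (-K ^ 10)‖₊ * R + 4 * ‖ε⁻¹ * K ^ 10‖₊ * R +
    4 * ‖(ε ^ 2)⁻¹‖₊ * R + 4 * ‖K‖₊ * R

/-- (5.5) is `delayLipschitz K ε R`-Lipschitz on the sup-ball of radius `R` (gate by gate, via
`delayCircuit_eq_gates`). [cite: Tao2016AveragedNS, §5.5 (5.5)] -/
theorem lipschitzOnWith_delayCircuit (K ε : ℝ) (R : ℝ≥0) :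
    LipschitzOnWith (delayLipschitz K ε R) (delayCircuit K ε) (closedBall (0 : Fin 5 → ℝ) R) := by
  rw [delayCircuit_eq_gates]
  exact ((((lipschitzOnWith_pumpOn ε 0 1 R).add
    (lipschitzOnWith_pumpOn (ε ^ 2 * Real.exp (-K ^ 10)) 0 2 R)).add
    (lipschitzOnWith_amplifierOn (ε⁻¹ * K ^ 10) 1 2 R)).add
    (lipschitzOnWith_rotorOn ((ε ^ 2)⁻¹) 0 3 2 R)).add (lipschitzOnWith_pumpOn K 3 4 R)

/-- The constant in real terms: `delayLipschitz K ε R = 4R(ε + ε²e^{-K¹⁰} + ε⁻¹K¹⁰ + ε⁻² + K)` for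
`ε > 0`, `K ≥ 0`. [cite: Tao2016AveragedNS, §5.5 (5.5)] -/
theorem coe_delayLipschitz {K ε : ℝ} (hK : 0 ≤ K) (hε : 0 < ε) (R : ℝ≥0) :
    (delayLipschitz K ε R : ℝ) =
      4 * R * (ε + ε ^ 2 * Real.exp (-K ^ 10) + ε⁻¹ * K ^ 10 + (ε ^ 2)⁻¹ + K) := by
  simp only [delayLipschitz, NNReal.coe_add, NNReal.coe_mul, NNReal.coe_ofNat, coe_nnnorm,
    Real.norm_eq_abs]
  rw [abs_of_pos hε, abs_of_nonneg (by positivity : (0 : ℝ) ≤ ε ^ 2 * Real.exp (-K ^ 10)),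
    abs_of_nonneg (by positivity : (0 : ℝ) ≤ ε⁻¹ * K ^ 10),
    abs_of_nonneg (by positivity : (0 : ℝ) ≤ (ε ^ 2)⁻¹), abs_of_nonneg hK]
  ring

/-- In Tao's regime `0 < ε ≤ 1 ≤ K` the constant is at most `20 R K¹⁰ ε⁻²` (the rotor speed `ε⁻²`
and the amplifier gain `ε⁻¹K¹⁰` dominate). [cite: Tao2016AveragedNS, §5.5 (5.5)] -/
theorem delayLipschitz_le {K ε : ℝ} (hK : 1 ≤ K) (hε : 0 < ε) (hε1 : ε ≤ 1) (R : ℝ≥0) :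
    (delayLipschitz K ε R : ℝ) ≤ 20 * R * K ^ 10 / ε ^ 2 := by
  rw [coe_delayLipschitz (by linarith) hε]
  have hR : (0 : ℝ) ≤ R := R.coe_nonneg
  have hK10 : 1 ≤ K ^ 10 := one_le_pow₀ hK
  have hKK : K ≤ K ^ 10 := by
    calc K = K ^ 1 := (pow_one K).symm
      _ ≤ K ^ 10 := pow_le_pow_right₀ hK (by norm_num)
  have hε2 : 0 < ε ^ 2 := by positivity
  have hε2le : ε ^ 2 ≤ 1 := by nlinarith
  have hinv : 1 ≤ (ε ^ 2)⁻¹ := one_le_inv_iff₀.2 ⟨hε2, hε2le⟩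
  have hexp : Real.exp (-K ^ 10) ≤ 1 := Real.exp_le_one_iff.2 (by linarith)
  -- each of the five couplings is at most `K¹⁰/ε²`
  have h1 : ε ≤ K ^ 10 / ε ^ 2 := by
    rw [le_div_iff₀ hε2]
    calc ε * ε ^ 2 ≤ 1 * 1 := mul_le_mul hε1 hε2le hε2.le zero_le_one
      _ = 1 := one_mul 1
      _ ≤ K ^ 10 := hK10
  have h2 : ε ^ 2 * Real.exp (-K ^ 10) ≤ K ^ 10 / ε ^ 2 := by
    rw [le_div_iff₀ hε2]
    calc ε ^ 2 * Real.exp (-K ^ 10) * ε ^ 2 ≤ 1 * 1 * 1 :=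
          mul_le_mul (mul_le_mul hε2le hexp (Real.exp_pos _).le zero_le_one) hε2le hε2.le
            (by norm_num)
      _ = 1 := by norm_num
      _ ≤ K ^ 10 := hK10
  have h3 : ε⁻¹ * K ^ 10 ≤ K ^ 10 / ε ^ 2 := by
    rw [div_eq_mul_inv, mul_comm (K ^ 10)]
    refine mul_le_mul_of_nonneg_right ?_ (by positivity)
    rw [inv_le_inv₀ hε hε2]
    calc ε ^ 2 = ε * ε := pow_two ε
      _ ≤ 1 * ε := mul_le_mul_of_nonneg_right hε1 hε.le
      _ = ε := one_mul ε
  have h4 : (ε ^ 2)⁻¹ ≤ K ^ 10 / ε ^ 2 := by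
    rw [div_eq_mul_inv]
    exact le_mul_of_one_le_left (by positivity) hK10
  have h5 : K ≤ K ^ 10 / ε ^ 2 := by
    rw [div_eq_mul_inv]
    exact hKK.trans (le_mul_of_one_le_right (by positivity) hinv)
  calc 4 * (R : ℝ) * (ε + ε ^ 2 * Real.exp (-K ^ 10) + ε⁻¹ * K ^ 10 + (ε ^ 2)⁻¹ + K)
      ≤ 4 * R * (K ^ 10 / ε ^ 2 + K ^ 10 / ε ^ 2 + K ^ 10 / ε ^ 2 + K ^ 10 / ε ^ 2
          + K ^ 10 / ε ^ 2) := by gcongr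
    _ = 20 * R * K ^ 10 / ε ^ 2 := by ring

/-- THE trajectory of (5.5)/(5.6) lives in the unit sup-ball ((energy-con)).
[cite: Tao2016AveragedNS, §5.5 (energy-con)] -/
theorem norm_delaySolution_le_one (K ε t : ℝ) : ‖delaySolution K ε t‖ ≤ 1 := by
  simpa [energy_delaySolution] using norm_le_sqrt_energy (delaySolution K ε t)

/-- THE trajectory is continuous. [cite: Tao2016AveragedNS, §5.5 (5.5)] -/
theorem continuous_delaySolution (K ε : ℝ) : Continuous (delaySolution K ε) :=
  continuous_iff_continuousAt.2 fun t => (hasDerivAt_delaySolution K ε t).continuousAt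

/-- THE trajectory is a `0`-pseudo-orbit in every ball of radius `R ≥ 1`, over every window.
[cite: Tao2016AveragedNS, §5.5 (5.5)–(5.6)] -/
theorem delaySolution_isPseudoOrbit (K ε T : ℝ) {R : ℝ≥0} (hR : 1 ≤ R) :
    IsPseudoOrbit (delayCircuit K ε) 0 R T (delaySolution K ε) :=
  IsPseudoOrbit.of_hasDerivAt (hasDerivAt_delaySolution K ε) fun t _ =>
    (norm_delaySolution_le_one K ε t).trans (NNReal.one_le_coe.2 hR)

/-- **Shadowing of the gate.** A `δ`-pseudo-orbit of (5.5) over `[0,T]`, confined to the sup-ball of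
radius `R ≥ 1` and issued `δ₀`-close to (5.6), stays within
`gronwallBound δ₀ (delayLipschitz K ε R) δ t` of THE trajectory `delaySolution K ε`.
[cite: HairerNorsettWanner1993, Thm I.10.2] -/
theorem IsPseudoOrbit.norm_sub_delaySolution_le {K ε δ T δ₀ : ℝ} {R : ℝ≥0} {Y : ℝ → Fin 5 → ℝ}
    (hY : IsPseudoOrbit (delayCircuit K ε) δ R T Y) (hR : 1 ≤ R) (h0 : ‖Y 0 - delayInit‖ ≤ δ₀)
    {t : ℝ} (ht : t ∈ Icc 0 T) :
    ‖Y t - delaySolution K ε t‖ ≤ gronwallBound δ₀ (delayLipschitz K ε R) δ t := by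
  have h00 : ‖Y 0 - delaySolution K ε 0‖ ≤ δ₀ := by rwa [delaySolution_zero]
  have h := hY.norm_sub_le (lipschitzOnWith_delayCircuit K ε R)
    (delaySolution_isPseudoOrbit K ε T hR) h00 ht
  rwa [add_zero] at h

/-! ## Level `n` (Remark 6.1): the admissible forcing is generation-independent in rescaled units -/

/-- **Pseudo-orbits rescale.** If `Y` is a `δ`-pseudo-orbit of the level-`n` copy
`∂ₜY = Λ • delayCircuit K ε Y` of the circuit (coupling `Λ = Λₙ = (1+ε₀)^{5n/2}`, run at amplitude
`e = eₙ`: radius `≤ e R`, window `Tₙ ≥ T/(Λe)`; `hasDerivAt_delayCircuit_rescale`), then in the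
rescaled variables `s = Λe·t`, `Ỹ(s) = e⁻¹ Y(s/(Λe))` it is a `δ/(Λe²)`-pseudo-orbit of the UNIT
circuit (5.5) in the ball of radius `R` over `[0,T]`. Hence the forcing a generation tolerates,
measured against its natural rate `Λₙeₙ²`, is the generation-independent `shadowRadius` below — the
"uniform spec over all scales". [cite: Tao2016AveragedNS, Remark 6.1] -/
theorem IsPseudoOrbit.rescale {K ε Λ e δ T Tn : ℝ} {R Rn : ℝ≥0} {Y : ℝ → Fin 5 → ℝ}
    (hY : IsPseudoOrbit (fun X => Λ • delayCircuit K ε X) δ Rn Tn Y) (hΛ : 0 < Λ) (he : 0 < e)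
    (hR : (Rn : ℝ) ≤ e * R) (hT : T ≤ Λ * e * Tn) :
    IsPseudoOrbit (delayCircuit K ε) (δ / (Λ * e ^ 2)) R T (fun s => e⁻¹ • Y ((Λ * e)⁻¹ * s)) := by
  have hΛe : 0 < Λ * e := mul_pos hΛ he
  set c := (Λ * e)⁻¹ with hc
  have hc0 : 0 < c := inv_pos.2 hΛe
  have hcT : c * T ≤ Tn := by
    calc c * T ≤ c * (Λ * e * Tn) := mul_le_mul_of_nonneg_left hT hc0.le
      _ = Tn := by rw [hc, ← mul_assoc, inv_mul_cancel₀ hΛe.ne', one_mul]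
  have hIco : ∀ s ∈ Ico 0 T, c * s ∈ Ico 0 Tn := fun s hs =>
    ⟨mul_nonneg hc0.le hs.1, (mul_lt_mul_of_pos_left hs.2 hc0).trans_le hcT⟩
  have hIcc : MapsTo (fun s => c * s) (Icc 0 T) (Icc 0 Tn) := fun s hs =>
    ⟨mul_nonneg hc0.le hs.1, (mul_le_mul_of_nonneg_left hs.2 hc0.le).trans hcT⟩
  have hec : 0 < e⁻¹ * c := mul_pos (inv_pos.2 he) hc0
  have hcΛ : e⁻¹ * c * Λ = e⁻¹ ^ 2 := by
    rw [hc, mul_inv]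
    calc e⁻¹ * (Λ⁻¹ * e⁻¹) * Λ = e⁻¹ ^ 2 * (Λ⁻¹ * Λ) := by ring
      _ = e⁻¹ ^ 2 := by rw [inv_mul_cancel₀ hΛ.ne', mul_one]
  refine ⟨?_, fun s hs => ?_, fun s hs => ?_⟩
  · -- continuity of the rescaled curve on `[0,T]`
    exact (hY.continuousOn.comp (continuous_const_mul c).continuousOn hIcc).fun_const_smul e⁻¹
  · -- right derivative and defect
    obtain ⟨V, hV, hVδ⟩ := hY.defect (c * s) (hIco s hs)
    have hcs : HasDerivWithinAt (fun s : ℝ => c * s) c (Ici s) s := by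
      simpa using ((hasDerivWithinAt_id s (Ici s)).const_mul c)
    have hmaps : MapsTo (fun s : ℝ => c * s) (Ici s) (Ici (c * s)) := fun x hx =>
      mul_le_mul_of_nonneg_left hx hc0.le
    have h1 : HasDerivWithinAt (fun s => Y (c * s)) (c • V) (Ici s) s := by
      have := hV.scomp s hcs hmaps
      simpa [Function.comp_def] using this
    have h2 := h1.fun_const_smul e⁻¹
    have key : e⁻¹ • c • V - delayCircuit K ε (e⁻¹ • Y (c * s)) =
        (e⁻¹ * c) • (V - Λ • delayCircuit K ε (Y (c * s))) := by
      rw [delayCircuit_smul, smul_sub, smul_smul, smul_smul, hcΛ]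
    have bound : ‖e⁻¹ • c • V - delayCircuit K ε (e⁻¹ • Y (c * s))‖ ≤ δ / (Λ * e ^ 2) := by
      rw [key, norm_smul, Real.norm_eq_abs, abs_of_pos hec]
      calc e⁻¹ * c * ‖V - Λ • delayCircuit K ε (Y (c * s))‖ ≤ e⁻¹ * c * δ :=
            mul_le_mul_of_nonneg_left hVδ hec.le
        _ = δ / (Λ * e ^ 2) := by rw [hc]; ring
    exact ⟨e⁻¹ • c • V, h2, bound⟩
  · -- confinement
    have hYn := (hY.norm_le (c * s) (hIco s hs)).trans hR
    show ‖e⁻¹ • Y (c * s)‖ ≤ R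
    rw [norm_smul, Real.norm_eq_abs, abs_of_pos (inv_pos.2 he)]
    calc e⁻¹ * ‖Y (c * s)‖ ≤ e⁻¹ * (e * R) := mul_le_mul_of_nonneg_left hYn (inv_pos.2 he).le
      _ = R := by rw [← mul_assoc, inv_mul_cancel₀ he.ne', one_mul]

/-! ## Robust Theorem 5.3: the transition survives along pseudo-orbits -/

/-- Coordinates of a pseudo-orbit inherit the reference bounds up to the shadowing error. [folklore] -/
theorem abs_sub_le_of_norm_sub_le {Y X : Fin 5 → ℝ} {g c a : ℝ} (h : ‖Y - X‖ ≤ g) {i : Fin 5}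
    (hX : |X i - a| ≤ c) : |Y i - a| ≤ c + g := by
  have hi : |Y i - X i| ≤ g := le_trans (by rw [← Real.norm_eq_abs]; exact norm_le_pi_norm (Y - X) i) h
  calc |Y i - a| = |(X i - a) + (Y i - X i)| := by congr 1; ring
    _ ≤ |X i - a| + |Y i - X i| := abs_add_le _ _
    _ ≤ c + g := add_le_add hX hi

/-- The same with reference value `0`. [folklore] -/
theorem abs_le_of_norm_sub_le {Y X : Fin 5 → ℝ} {g c : ℝ} (h : ‖Y - X‖ ≤ g) {i : Fin 5}
    (hX : |X i| ≤ c) : |Y i| ≤ c + g := by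
  simpa using abs_sub_le_of_norm_sub_le (a := 0) (i := i) (c := c) h (by simpa using hX)

/-- **Theorem 5.3 along a pseudo-orbit (conditional form).** If THE trajectory `delaySolution K ε`
undergoes the delayed abrupt transition with constants `C`, `K` (`HasAbruptTransition`, the body of
Theorem 5.3), then every `δ`-pseudo-orbit `Y` of (5.5) over `[0,T]` in the ball of radius `R ≥ 1`,
`δ₀`-close to (5.6) at time `0`, satisfies the same two-window conclusion on `[0,T]` with `C K⁻¹⁰`
replaced by `C K⁻¹⁰ + gronwallBound δ₀ (delayLipschitz K ε R) δ t`: before `t_c - K^{-1/2}` the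
input mode is `1` and the others vanish up to that tolerance; from `t_c + K^{-1/2}` on the output
mode is `1` and the others vanish up to that tolerance. [cite: Tao2016AveragedNS, Theorem 5.3] -/
theorem IsPseudoOrbit.abruptTransition_shadow {K ε δ T δ₀ C : ℝ} {R : ℝ≥0} {Y : ℝ → Fin 5 → ℝ}
    (hY : IsPseudoOrbit (delayCircuit K ε) δ R T Y) (hR : 1 ≤ R) (h0 : ‖Y 0 - delayInit‖ ≤ δ₀)
    (hX : HasAbruptTransition C K (delaySolution K ε)) :
    ∃ tc : ℝ, |tc - Real.sqrt 2| ≤ C / Real.sqrt K ∧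
      (∀ t ∈ Icc 0 T, t ≤ tc - 1 / Real.sqrt K →
        |Y t 0 - 1| ≤ C / K ^ 10 + gronwallBound δ₀ (delayLipschitz K ε R) δ t ∧
        ∀ i : Fin 5, i ≠ 0 → |Y t i| ≤ C / K ^ 10 + gronwallBound δ₀ (delayLipschitz K ε R) δ t) ∧
      (∀ t ∈ Icc 0 T, tc + 1 / Real.sqrt K ≤ t →
        |Y t 4 - 1| ≤ C / K ^ 10 + gronwallBound δ₀ (delayLipschitz K ε R) δ t ∧
        ∀ i : Fin 5, i ≠ 4 → |Y t i| ≤ C / K ^ 10 + gronwallBound δ₀ (delayLipschitz K ε R) δ t) := by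
  obtain ⟨tc, htc, hbefore, hafter⟩ := hX
  refine ⟨tc, htc, fun t ht htb => ?_, fun t ht hta => ?_⟩
  · have hg := hY.norm_sub_delaySolution_le hR h0 ht
    obtain ⟨h0', hi'⟩ := hbefore t ⟨ht.1, htb⟩
    exact ⟨abs_sub_le_of_norm_sub_le hg h0', fun i hi => abs_le_of_norm_sub_le hg (hi' i hi)⟩
  · have hg := hY.norm_sub_delaySolution_le hR h0 ht
    obtain ⟨h4', hi'⟩ := hafter t hta
    exact ⟨abs_sub_le_of_norm_sub_le hg h4', fun i hi => abs_le_of_norm_sub_le hg (hi' i hi)⟩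

/-- **Theorem 5.3 along pseudo-orbits (unconditional).** With the absolute constant `C`, threshold
`K₀` and `ε₁(K)` of the tree's proof of Theorem 5.3 (`DelayedAbruptTransition_holds`,
`delaySolution_hasAbruptTransition`): for `K ≥ K₀`, `0 < ε ≤ ε₁(K)`, EVERY pseudo-orbit of (5.5)
near (5.6) exhibits the delayed abrupt energy transition up to its shadowing error.
[cite: Tao2016AveragedNS, Theorem 5.3] -/
theorem pseudoOrbit_delayedAbruptTransition :
    ∃ C : ℝ, 0 < C ∧ ∃ K₀ : ℝ, 0 < K₀ ∧ ∀ K : ℝ, K₀ ≤ K → ∃ ε₁ : ℝ, 0 < ε₁ ∧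
      ∀ ε : ℝ, 0 < ε → ε ≤ ε₁ → ∀ (R : ℝ≥0), 1 ≤ R → ∀ (δ δ₀ T : ℝ) (Y : ℝ → Fin 5 → ℝ),
        IsPseudoOrbit (delayCircuit K ε) δ R T Y → ‖Y 0 - delayInit‖ ≤ δ₀ →
        ∃ tc : ℝ, |tc - Real.sqrt 2| ≤ C / Real.sqrt K ∧
          (∀ t ∈ Icc 0 T, t ≤ tc - 1 / Real.sqrt K →
            |Y t 0 - 1| ≤ C / K ^ 10 + gronwallBound δ₀ (delayLipschitz K ε R) δ t ∧
            ∀ i : Fin 5, i ≠ 0 →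
              |Y t i| ≤ C / K ^ 10 + gronwallBound δ₀ (delayLipschitz K ε R) δ t) ∧
          (∀ t ∈ Icc 0 T, tc + 1 / Real.sqrt K ≤ t →
            |Y t 4 - 1| ≤ C / K ^ 10 + gronwallBound δ₀ (delayLipschitz K ε R) δ t ∧
            ∀ i : Fin 5, i ≠ 4 →
              |Y t i| ≤ C / K ^ 10 + gronwallBound δ₀ (delayLipschitz K ε R) δ t) := by
  obtain ⟨C, hC, K₀, hK₀, h⟩ := delaySolution_hasAbruptTransition
  refine ⟨C, hC, K₀, hK₀, fun K hK => ?_⟩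
  obtain ⟨ε₁, hε₁, hε⟩ := h K hK
  exact ⟨ε₁, hε₁, fun ε hε0 hεle R hR δ δ₀ T Y hY h0 =>
    hY.abruptTransition_shadow hR h0 (hε ε hε0 hεle)⟩

/-! ## The number: forcing budget and the worst-case robustness radius of the gate -/

/-- **Firing on a budget.** Under the hypotheses of `abruptTransition_shadow`, if the forcing budget
obeys `(δ₀ + δT)·exp(delayLipschitz K ε R · T) ≤ θ`, then on `[0,T]` the pseudo-orbit's output
mode satisfies `ã ≥ 1 - C K⁻¹⁰ - θ` from `t_c + K^{-1/2}` on, the non-output modes are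
`≤ C K⁻¹⁰ + θ` there, and before `t_c - K^{-1/2}` the input mode is within `C K⁻¹⁰ + θ` of `1` and
the other modes are `≤ C K⁻¹⁰ + θ` — the delayed abrupt transition with efficiency loss `θ`.
[cite: Tao2016AveragedNS, Theorem 5.3] -/
theorem IsPseudoOrbit.fires_of_budget {K ε δ T δ₀ C θ : ℝ} {R : ℝ≥0} {Y : ℝ → Fin 5 → ℝ}
    (hY : IsPseudoOrbit (delayCircuit K ε) δ R T Y) (hR : 1 ≤ R) (h0 : ‖Y 0 - delayInit‖ ≤ δ₀)
    (hδ : 0 ≤ δ) (hX : HasAbruptTransition C K (delaySolution K ε))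
    (hθ : (δ₀ + δ * T) * Real.exp (delayLipschitz K ε R * T) ≤ θ) :
    ∃ tc : ℝ, |tc - Real.sqrt 2| ≤ C / Real.sqrt K ∧
      (∀ t ∈ Icc 0 T, t ≤ tc - 1 / Real.sqrt K →
        |Y t 0 - 1| ≤ C / K ^ 10 + θ ∧ ∀ i : Fin 5, i ≠ 0 → |Y t i| ≤ C / K ^ 10 + θ) ∧
      (∀ t ∈ Icc 0 T, tc + 1 / Real.sqrt K ≤ t →
        1 - C / K ^ 10 - θ ≤ Y t 4 ∧ ∀ i : Fin 5, i ≠ 4 → |Y t i| ≤ C / K ^ 10 + θ) := by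
  have hδ₀ : 0 ≤ δ₀ := (norm_nonneg _).trans h0
  have hL : (0 : ℝ) ≤ delayLipschitz K ε R := NNReal.coe_nonneg _
  -- the shadowing error is below `θ` on the whole window
  have hgθ : ∀ t ∈ Icc 0 T, gronwallBound δ₀ (delayLipschitz K ε R) δ t ≤ θ := by
    intro t ht
    refine (Literature.Analysis.ODE.gronwallBound_le_mul_exp (x := t) hδ hL).trans
      (le_trans ?_ hθ)
    have hT : t ≤ T := ht.2
    have hT0 : 0 ≤ T := ht.1.trans ht.2
    gcongr
  obtain ⟨tc, htc, hbefore, hafter⟩ := hY.abruptTransition_shadow hR h0 hX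
  refine ⟨tc, htc, fun t ht htb => ?_, fun t ht hta => ?_⟩
  · obtain ⟨ha, hi⟩ := hbefore t ht htb
    exact ⟨ha.trans (by linarith [hgθ t ht]), fun i hne => (hi i hne).trans (by linarith [hgθ t ht])⟩
  · obtain ⟨ha, hi⟩ := hafter t ht hta
    refine ⟨?_, fun i hne => (hi i hne).trans (by linarith [hgθ t ht])⟩
    have := (abs_sub_le_iff.1 ha).2
    linarith [hgθ t ht]

/-- **The worst-case (Grönwall) robustness radius of the gate**: the forcing budget
`δ₀ + δT ≤ shadowRadius K ε R T θ := θ·exp(-delayLipschitz K ε R · T)` guarantees firing with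
efficiency loss `≤ θ` (`fires_of_le_shadowRadius`). This is the cell's kernel-checked yardstick for
the robustness of ONE gate against GENERIC forcing, in the gate's own (rescaled) units; it is a
SUFFICIENT radius, not a necessary one. [cite: HairerNorsettWanner1993, Thm I.10.2] -/
def shadowRadius (K ε : ℝ) (R : ℝ≥0) (T θ : ℝ) : ℝ :=
  θ * Real.exp (-(delayLipschitz K ε R * T))

/-- A budget below `shadowRadius` meets the hypothesis of `fires_of_budget`. [folklore] -/
theorem budget_of_le_shadowRadius {K ε T θ δ₀ δ : ℝ} {R : ℝ≥0}
    (h : δ₀ + δ * T ≤ shadowRadius K ε R T θ) :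
    (δ₀ + δ * T) * Real.exp (delayLipschitz K ε R * T) ≤ θ := by
  have hE := Real.exp_pos (delayLipschitz K ε R * T)
  have := mul_le_mul_of_nonneg_right h hE.le
  rw [shadowRadius, mul_assoc, ← Real.exp_add, neg_add_cancel, Real.exp_zero, mul_one] at this
  exact this

/-- **Firing below the shadow radius.** [cite: Tao2016AveragedNS, Theorem 5.3] -/
theorem IsPseudoOrbit.fires_of_le_shadowRadius {K ε δ T δ₀ C θ : ℝ} {R : ℝ≥0}
    {Y : ℝ → Fin 5 → ℝ} (hY : IsPseudoOrbit (delayCircuit K ε) δ R T Y) (hR : 1 ≤ R)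
    (h0 : ‖Y 0 - delayInit‖ ≤ δ₀) (hδ : 0 ≤ δ) (hX : HasAbruptTransition C K (delaySolution K ε))
    (hθ : δ₀ + δ * T ≤ shadowRadius K ε R T θ) :
    ∃ tc : ℝ, |tc - Real.sqrt 2| ≤ C / Real.sqrt K ∧
      (∀ t ∈ Icc 0 T, t ≤ tc - 1 / Real.sqrt K →
        |Y t 0 - 1| ≤ C / K ^ 10 + θ ∧ ∀ i : Fin 5, i ≠ 0 → |Y t i| ≤ C / K ^ 10 + θ) ∧
      (∀ t ∈ Icc 0 T, tc + 1 / Real.sqrt K ≤ t →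
        1 - C / K ^ 10 - θ ≤ Y t 4 ∧ ∀ i : Fin 5, i ≠ 4 → |Y t i| ≤ C / K ^ 10 + θ) :=
  hY.fires_of_budget hR h0 hδ hX (budget_of_le_shadowRadius hθ)

/-- **How small the radius is**: `shadowRadius K ε R T θ ≤ θ·exp(-4RT/ε²)` (`θ, T ≥ 0`, `ε > 0`,
`K ≥ 0`) — exponentially small in the rotor speed `ε⁻²` (and, keeping the amplifier term instead,
in `ε⁻¹K¹⁰`). [cite: Tao2016AveragedNS, §5.5 (5.5)] -/
theorem shadowRadius_le {K ε T θ : ℝ} {R : ℝ≥0} (hK : 0 ≤ K) (hε : 0 < ε) (hT : 0 ≤ T)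
    (hθ : 0 ≤ θ) : shadowRadius K ε R T θ ≤ θ * Real.exp (-(4 * R * T / ε ^ 2)) := by
  unfold shadowRadius
  refine mul_le_mul_of_nonneg_left (Real.exp_le_exp.2 (neg_le_neg ?_)) hθ
  rw [coe_delayLipschitz hK hε]
  have hR : (0 : ℝ) ≤ R := R.coe_nonneg
  have h4 : 4 * (R : ℝ) * (ε ^ 2)⁻¹ ≤
      4 * R * (ε + ε ^ 2 * Real.exp (-K ^ 10) + ε⁻¹ * K ^ 10 + (ε ^ 2)⁻¹ + K) := by
    refine mul_le_mul_of_nonneg_left ?_ (by positivity)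
    have : 0 ≤ ε + ε ^ 2 * Real.exp (-K ^ 10) + ε⁻¹ * K ^ 10 + K := by positivity
    linarith
  calc 4 * (R : ℝ) * T / ε ^ 2 = 4 * R * (ε ^ 2)⁻¹ * T := by ring
    _ ≤ 4 * R * (ε + ε ^ 2 * Real.exp (-K ^ 10) + ε⁻¹ * K ^ 10 + (ε ^ 2)⁻¹ + K) * T :=
        mul_le_mul_of_nonneg_right h4 hT

end Literature.Analysis.FluidPDE.Tao2016AveragedNS
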